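import Summits.PneNP.PneNP.Theorems.ChebyshevTracialDesignUnconditionalRungs
import Summits.PneNP.PneNP.Theorems.ChebyshevTracialDesignTightMassBicliques
import HarnessLib

/-!
# Cell pnp-psdrank, route `ChebyshevTracialDesign`: SNT₀ IN SHADOW FORM, UNCONDITIONAL — the tight mass of a dense × homogeneous-dense weighted
# rectangle, read through the biclique skeleton, is a mass statement for the EVEN sets `W` and their splitting classes `Z(W)`
# (crux `TracialDecayExp20`, stmt-PneNP-19878)

Brick 82 (prover g14; MEMO-16 §1 (⋆), g12's ask 'SNT₀ for even cuts', MEMO-17). Brick 77 (`sum_Qset_one_mul_eq`): the tight mass is a sum over even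
`(t−1)`-sets, `Σ_{(U,M) ∈ Q_1(t)} f(U) g(M) = Σ_{|W| = t−1} f⁺(W)·g(Z(W))` with the UPPER-SHADOW weight `f⁺(W) = Σ_{a ∉ W} f(W + a)` and
`Z(W) = {M : cc(W,M) = 0}` (the matchings splitting along `W`). Brick 70b (`tight_mass_ge`), now UNCONDITIONAL (brick 81, `tight_mass_ge_holds`):
the tight mass of a `t`-cut weight `x` of density `μ` against a `(PM_n, τ)`-homogeneous matching weight `z` of density `ν` (both above `exp(−c₀·dq n)`)
is `≥ (29/960)·μ·ν·|Q_1(t)|`. Together (`shadow_mass_ge`):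
    `Σ_{|W| = t−1} x⁺(W) · z(Z(W)) ≥ (29/960)·μ·ν·|Q_1(t)|`,
i.e. the even sets under the cut weight carry, in `x⁺`-average, a `z`-mass of splitting matchings at least a constant fraction of its mean — the
'SNT₀ in shadow form' that the link-rigidity line (MEMO-15 §3(ii), MEMO-16 §1) consumes (for the `W` under ACTIVE cuts), with no hypothesis left.
A genuinely even-set-indexed SNT₀ (an arbitrary dense weight `ξ` on `(t−1)`-sets in place of the shadow `x⁺`) does NOT follow and is not claimed.
[cite: KeevashLifshitz2023, Thm. 1.8] [cite: KupavskiiZakharov2022, §2] [cite: Rothvoss2017, §2 (PDF p. 6: the tight pairs `Q_1`)] [cite: AlonSpencer2016, Appendix A.1]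
Stature: support/instrument (a rewriting of the unconditional mass-form SNT). WHAT THIS IS NOT: no SNT for arbitrary even-set weights, nothing on psd
rank of P_PM(K_n), no P-vs-NP content.
-/

set_option linter.dupNamespace false -- `Summit.PneNP.PneNP.…`: summit = sub-problem (D-0017)

noncomputable section

namespace Summit.PneNP.PneNP.Theorems.ChebyshevTracialDesignShadowSNT

open Finset Literature.Barriers.PneNP Literature.Combinatorics.Optimization
open Literature.Combinatorics.SetFamily
open Literature.Combinatorics.AssociationSchemes.CutMatchingRestriction
open Literature.Combinatorics.AssociationSchemes.HomogeneousMatchingFamilies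
open Summit.PneNP.PneNP.Theorems.ChebyshevTracialDesignTightMassBicliques (sum_Qset_one_mul_eq)
open Summit.PneNP.PneNP.Theorems.ChebyshevTracialDesignUnconditionalRungs (tight_mass_ge_holds)

variable {n : ℕ}

/-- The tight mass of a `t`-cut weight `x` (vanishing off the `t`-cuts) against `z` is the sum of `x_U z_M` over `Q_1(t)`.
[cite: Rothvoss2017, §2 (PDF p. 6: the pairs `Q_ℓ`)] -/
theorem tight_mass_eq_sum_Qset {t : ℕ} (x : OddSet n → ℝ) (z : PMatch n → ℝ) (hxt : ∀ U, U.1.card ≠ t → x U = 0) :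
    ∑ U, ∑ M, x U * z M * (if cc U M = 1 then (1 : ℝ) else 0) = ∑ p ∈ Qset n t 1, x p.1 * z p.2 := by
  rw [Qset, sum_filter, ← univ_product_univ, sum_product]
  refine sum_congr rfl fun U _ => sum_congr rfl fun M _ => ?_
  by_cases hU : U.1.card = t
  · by_cases hc : cc U M = 1
    · rw [if_pos hc, mul_one, if_pos ⟨hU, hc⟩]
    · rw [if_neg hc, mul_zero, if_neg (fun h => hc h.2)]
  · rw [hxt U hU, zero_mul, zero_mul, if_neg (fun h => hU h.1)]

/-- **The tight mass in shadow form**: `Σ_U Σ_M x_U z_M [cc = 1] = Σ_{|W| = t−1} x⁺(W) · z(Z(W))`, `x⁺(W) = Σ_{a ∉ W} x(W + a)` (brick 77 read for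
weights; `x` vanishing off the `t`-cuts, `t` odd). [cite: Rothvoss2017, §2 (PDF p. 6: the tight pairs `Q_1`)] -/
theorem tight_mass_eq_shadow {t : ℕ} (ht : Odd t) (x : OddSet n → ℝ) (z : PMatch n → ℝ) (hxt : ∀ U, U.1.card ≠ t → x U = 0) :
    ∑ U, ∑ M, x U * z M * (if cc U M = 1 then (1 : ℝ) else 0) =
      ∑ W ∈ (univ : Finset (Finset (Fin n))).filter (fun W => W.card + 1 = t),
        (∑ a ∈ univ.filter (fun a => a ∉ W), (if h : Odd (insert a W).card then x ⟨insert a W, h⟩ else 0)) *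
          (∑ M ∈ univ.filter (fun M : PMatch n => crossCount W M.1 = 0), z M) := by
  rw [tight_mass_eq_sum_Qset x z hxt, ← sum_Qset_one_mul_eq ht (fun V => if h : Odd V.card then x ⟨V, h⟩ else 0) z]
  refine sum_congr rfl fun p _ => ?_
  rw [dif_pos p.1.2]

/-- **SNT₀ IN SHADOW FORM — UNCONDITIONAL.** For `τ ≥ 2` there are `c₀ > 0`, `n₁` such that for even `n ≥ n₁`, odd `t` with `n ≤ 5t`, `n ≤ 5(n−t)`,
thresholds `ε, ν ≥ exp(−c₀·dq n)`, every `x : OddSet n → [0,1]` vanishing off the `t`-cuts with `Σ x ≥ ε·#t-cuts` and every `z : PM_n → [0,1]` whose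
edge-set extension is `(PM_n, τ)`-homogeneous with `Σ z ≥ ν·#PM_n`:
  `(29/960)·(Σx/#t-cuts)·(Σz/#PM_n)·|Q_1(t)| ≤ Σ_{|W| = t−1} x⁺(W) · z(Z(W))`,
`x⁺(W) = Σ_{a ∉ W} x(W+a)`, `Z(W) = {M : cc(W,M) = 0}`. [cite: KeevashLifshitz2023, Thm. 1.8] [cite: KupavskiiZakharov2022, §2]
[cite: Rothvoss2017, §2 (PDF p. 6)] [cite: AlonSpencer2016, Appendix A.1] -/
theorem shadow_mass_ge {τ : ℝ} (hτ : 2 ≤ τ) :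
    ∃ c₀ : ℝ, 0 < c₀ ∧ ∃ n₁ : ℕ, ∀ (n t : ℕ), n₁ ≤ n → Even n → Odd t → n ≤ 5 * t → n ≤ 5 * (n - t) →
      ∀ (ε ν : ℝ), Real.exp (-(c₀ * dq n)) ≤ ε → Real.exp (-(c₀ * dq n)) ≤ ν →
      ∀ (x : OddSet n → ℝ) (z : PMatch n → ℝ), (∀ U, 0 ≤ x U ∧ x U ≤ 1) → (∀ U, U.1.card ≠ t → x U = 0) →
      ε * ((univ.filter fun U : OddSet n => U.1.card = t).card : ℝ) ≤ ∑ U, x U → (∀ M, 0 ≤ z M ∧ z M ≤ 1) →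
      IsRelHomogeneousW τ (perfectMatchings (univ : Finset (Fin n)))
        (fun M : Finset (Sym2 (Fin n)) => if hM : IsPMOn (univ : Finset (Fin n)) M then z ⟨M, hM⟩ else 0)
        ((univ : Finset (PMatch n)).image Subtype.val) →
      ν * (Fintype.card (PMatch n) : ℝ) ≤ ∑ M, z M →
      (29 / 960 : ℝ) * ((∑ U, x U) / ((univ.filter fun U : OddSet n => U.1.card = t).card : ℝ)) *
          ((∑ M, z M) / (Fintype.card (PMatch n) : ℝ)) * ((Qset n t 1).card : ℝ) ≤
        ∑ W ∈ (univ : Finset (Finset (Fin n))).filter (fun W => W.card + 1 = t),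
          (∑ a ∈ univ.filter (fun a => a ∉ W), (if h : Odd (insert a W).card then x ⟨insert a W, h⟩ else 0)) *
            (∑ M ∈ univ.filter (fun M : PMatch n => crossCount W M.1 = 0), z M) := by
  obtain ⟨c₀, hc₀, n₁, h⟩ := tight_mass_ge_holds hτ
  refine ⟨c₀, hc₀, n₁, fun n t hn hev hto h5 h5' ε ν hε hν x z hx hxt hxε hz hzh hzν => ?_⟩
  rw [← tight_mass_eq_shadow hto x z hxt]
  exact h n t hn hev hto h5 h5' ε ν hε hν x z hx hxt hxε hz hzh hzν

end Summit.PneNP.PneNP.Theorems.ChebyshevTracialDesignShadowSNT
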